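import Summits.HubbardSuperconductivity.HubbardSuperconductivity.Theorems.BalabanIRBirEveryGroundStateStubSectorSpectralCurve
import Summits.HubbardSuperconductivity.HubbardSuperconductivity.Theorems.BalabanIRBirEveryGroundStateStubLinearSheetForcesAffineGround
import Summits.HubbardSuperconductivity.HubbardSuperconductivity.Theorems.BalabanIRBirEveryGroundStateAnchorNonexceptional
import Summits.HubbardSuperconductivity.HubbardSuperconductivity.Theorems.BalabanIRBirEveryGroundStateSocketClosers
import Mathlib.LinearAlgebra.Matrix.Charpoly.Basic

/-!
# Route `BalabanIR`, crux 5 `BirEveryGroundState` (`stmt-HubbardSuperconductivity-2083`):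
# the line `spectral-curve-anchor` AUDITED — its open debt is ground-state UNIQUENESS

Theses-free (imports no route file and no module that does; rev-5 materialisation rule).

The line lead's skeleton `Cruxes/BirEveryGroundState/Lines/spectral_curve_anchor.lean` closes the
crux from six stubs; four are theorems of the tree (`stub_sectorSpectralCurve`,
`stub_anchorTransferNonexceptional`, `stub_linearSheetForcesAffineGround`, `stub_liebAnchor`) and
two are open and Hubbard-specific: `stub_groundSheetAnchored` (at a coupling `U > 0` that is
non-exceptional for all torus sides, under the eventual ground-state-AVERAGE bound, eventually in
even `L` every irreducible component of the sector spectral curve through the ground point is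
ANCHORED or the ground point lies on a LINEAR sheet) and `stub_noJointEigenGround` (same
hypotheses ⇒ eventually no sector ground state is a doublon-number eigenvector).

This module settles what the two open stubs SAY, side by side `L`, with the four landed ones:

* `finrankOne_or_forall_joint_of_anchoredOrLinear` — at a coupling non-exceptional for the side
  `L`, the anchored-or-linear dichotomy for the sector `szSector (2m) 0` implies: the sector ground
  eigenspace `E₀(U, L)` is ONE-dimensional, or EVERY sector ground state is an eigenvector of the
  doublon number `Σ_x n_{x↑} n_{x↓}` (anchored ⇒ the ground root is simple ⇒ `dim E₀ = 1` by the
  multiplicity clause; linear ⇒ the ground energy is affine near `U` ⇒ midpoint equality ⇒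
  `hubbard_jointEigen_of_midpoint`);
* `anchoredOrLinear_of_finrankOne_or_exists_joint` — conversely, at ANY coupling, `dim E₀ = 1`
  or ONE doublon-eigenvector ground state already gives the dichotomy (`dim E₀ = 1` ⇒ the ground
  point itself is an anchor; a joint `T/D` ground eigenvector rides the linear sheet
  `λ = (e₀ - γU) + γu`, which divides the sector curve because it carries a root at every complex
  coupling — division by a monic linear factor in `ℂ[u][λ]`).

Hence, at non-exceptional couplings, `stub_groundSheetAnchored` is EQUIVALENT to
"`dim E₀(U, L) = 1` or a doublon-eigenvector ground state", and together with
`stub_noJointEigenGround` the line's whole open debt is the curve-free statement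
UNIQUE GROUND STATES UNDER THE AVERAGE BOUND: at a coupling `U > 0` non-exceptional for all
sides, if eventually in even `L` the ground-state average of `Δ_d† Δ_d` is `≥ c L⁴ · dim E₀`,
then eventually in even `L` the sector ground state of `hubbardTorus 2 L 1 U` is NONDEGENERATE.
The companion module `BalabanIRBirEveryGroundStateUniqueGroundClosers.lean` derives that
statement from the two open stubs (`uniqueGroundUnderAvg_of_spectralCurveStubs`), closes the item
from it by pigeonhole alone (`birEveryGroundState_structural_of_uniqueGroundUnderAvg`, so the four
algebraic stubs are not needed for the closing), and records the line's own THESES-FREE closer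
`birEveryGroundState_structural_of_spectralCurveStubs` (the skeleton's `BirEveryGroundState_of`
imports the route file through `…Transfer`).

Nothing here proves either open stub or ground-state uniqueness (no printed source; the nearest
numerical study of ground degeneracies of Hubbard tori is Bruus–Anglès d'Auriac, PRB 55 (1997)
9142, §5: nondegenerate after symmetry reduction for `L ≠ 4`, dilute fillings). Kato (1966)
Ch. II §1.1, §6.1 (analytic pencils); Lieb, PRL 62 (1989) 1201 (sectors). Everything is folklore;
no definition is introduced.
-/

noncomputable section

namespace Summit.HubbardSuperconductivity.HubbardSuperconductivity.Theorems

open Polynomial Matrix Finset Filter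
open scoped Polynomial ComplexOrder
open Literature.Probability.LatticeModels Literature.MathematicalPhysics.QuantumLattice
open Literature.Computability.AlgebraicComplexity

namespace UniqueGround

/-! ## Glue at one side `L` -/

/-- Pencil form of the Hubbard torus Hamiltonian: `H(u) = H(0) + u · Σ_x n_{x↑} n_{x↓}`.
Tasaki (2020) §10.1. [folklore] -/
theorem hubbardTorus_pencil (L : ℕ) (u : ℝ) :
    hubbardTorus 2 L 1 u = hubbardTorus 2 L 1 0 +
      (u : ℂ) • (∑ x : FermionTorus 2 L, numberOp x 0 * numberOp x 1 :
        Matrix (Finset (Orb (FermionTorus 2 L))) (Finset (Orb (FermionTorus 2 L))) ℂ) :=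
  hamiltonian_eq_add_smul_doublon (fermionTorusGraph 2 L) 1 u

/-- **A root at every coupling is a linear sheet.** If a monic `χ ∈ ℂ[u][λ]` has `ε + γ u`
among its specialised roots at every complex coupling `u`, then the linear sheet
`λ - (ε + γ u)` divides `χ` (division with remainder by the monic linear factor; the remainder is
a polynomial in `u` vanishing identically). [folklore] -/
theorem X_sub_C_dvd_of_forall_isRoot (χ : ℂ[X][X]) (ε γ : ℂ)
    (h : ∀ u : ℂ, (χ.map (evalRingHom u)).IsRoot (ε + γ * u)) :
    (X - C (C ε + C γ * X)) ∣ χ := by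
  set q : ℂ[X][X] := X - C (C ε + C γ * X) with hq
  have hqm : q.Monic := monic_X_sub_C _
  -- the remainder has degree `< 1` in `λ`, so it is a constant `C r₀`, `r₀ ∈ ℂ[u]`
  have hqd : q.natDegree = 1 := by rw [hq]; exact natDegree_X_sub_C _
  have hq1 : q ≠ 1 := by
    intro h1
    have := congrArg natDegree h1
    rw [hqd, natDegree_one] at this
    exact one_ne_zero this
  have hdeg : (χ %ₘ q).natDegree = 0 := by
    have := natDegree_modByMonic_lt χ hqm hq1
    rw [hqd] at this
    omega
  have hC : χ %ₘ q = C ((χ %ₘ q).coeff 0) := eq_C_of_natDegree_eq_zero hdeg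
  -- specialising at `u`: the remainder becomes `χ(u, ε + γ u) = 0`
  have hspec : ∀ u : ℂ, ((χ %ₘ q).coeff 0).eval u = 0 := by
    intro u
    have hmap : (χ %ₘ q).map (evalRingHom u) = C (((χ %ₘ q).coeff 0).eval u) := by
      conv_lhs => rw [hC]
      rw [Polynomial.map_C, coe_evalRingHom]
    have hmap' : (χ %ₘ q).map (evalRingHom u) = 0 := by
      rw [Polynomial.map_modByMonic _ hqm]
      have hqu : q.map (evalRingHom u) = X - C (ε + γ * u) := by
        rw [hq, Polynomial.map_sub, Polynomial.map_X, Polynomial.map_C, coe_evalRingHom]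
        simp
      rw [hqu, modByMonic_X_sub_C_eq_C_eval, (h u).eq_zero, map_zero]
    have := hmap.symm.trans hmap'
    exact C_eq_zero.mp this
  have hr0 : (χ %ₘ q).coeff 0 = 0 := Polynomial.funext fun u => by
    rw [hspec u, eval_zero]
  rw [hr0, map_zero] at hC
  exact (modByMonic_eq_zero_iff_dvd hqm).mp hC

end UniqueGround

open UniqueGround

/-! ## The dichotomy of `stub_groundSheetAnchored` at one side, both ways -/

/-- **Anchored-or-linear ⇒ simple-or-joint** (one side `L`, one sector `szSector (2m) 0`, at a
coupling `U` non-exceptional for the side `L`). If, for every sector spectral curve `χ` of the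
pencil `hubbardTorus 2 L 1 0 + u · Σ_x n_{x↑} n_{x↓}` on the sector (characterised by its complex
roots and its real multiplicities) and every irreducible factor `p` of `χ` through the ground
point `(U, e₀)`, either `p` is ANCHORED (some specialised root of `p` is a simple root of `χ`) or
the ground point lies on a LINEAR sheet of `χ`, then: the sector ground eigenspace is
one-dimensional, or every sector ground state is an eigenvector of the doublon number.
(Anchored: `stub_anchorTransferNonexceptional` with `Φ = χ · charpoly` makes the ground root
simple, and the multiplicity clause turns that into `dim E₀ = 1`. Linear:
`stub_linearSheetForcesAffineGround` makes the sector ground energy affine near `U`, and the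
midpoint lemma `hubbard_jointEigen_of_midpoint` makes every ground state a doublon eigenvector.)
Kato (1966) Ch. II §1.1, §6.1. [folklore] -/
theorem finrankOne_or_forall_joint_of_anchoredOrLinear (L : ℕ) [NeZero L] (m : ℕ) (U : ℝ) (hmax : ∀ u' : ℝ, (hubbardTorus 2 L 1 u').charpoly.roots.toFinset.card ≤ (hubbardTorus 2 L 1 U).charpoly.roots.toFinset.card) (hdich : let T := hubbardTorus 2 L 1 0; let D : Matrix (Finset (Orb (FermionTorus 2 L))) (Finset (Orb (FermionTorus 2 L))) ℂ := ∑ x : FermionTorus 2 L, numberOp x 0 * numberOp x 1; let S := szSector (Λ := FermionTorus 2 L) (2 * m) 0; let e₀ : ℝ := (hubbardTorus 2 L 1 U).minEnergyOn S; ∀ χ : ℂ[X][X], χ.Monic → (∀ u μ : ℂ, (χ.map (evalRingHom u)).IsRoot μ ↔ ∃ v ∈ S, v ≠ 0 ∧ (T + u • D) *ᵥ v = μ • v) → (∀ u μ : ℝ, (χ.map (evalRingHom (u : ℂ))).rootMultiplicity (μ : ℂ) = Module.finrank ℂ ↥(S ⊓ Module.End.eigenspace (Matrix.toLin' (T + (u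 : ℂ) • D)) (μ : ℂ))) → ∀ p : ℂ[X][X], Irreducible p → p ∣ χ → (p.map (evalRingHom (U : ℂ))).IsRoot ((e₀ : ℝ) : ℂ) → (∃ U₀ μ₀ : ℂ, (p.map (evalRingHom U₀)).IsRoot μ₀ ∧ (χ.map (evalRingHom U₀)).rootMultiplicity μ₀ = 1) ∨ (∃ ε γ : ℂ, (X - C (C ε + C γ * X)) ∣ χ ∧ ((e₀ : ℝ) : ℂ) = ε + γ * (U : ℂ))) : let H := hubbardTorus 2 L 1 U; let S := szSector (Λ := FermionTorus 2 L) (2 * m) 0; let E₀ := S ⊓ Module.End.eigenspace (Matrix.toLin' H) ((H.minEnergyOn S : ℝ) : ℂ); Module.finrank ℂ E₀ = 1 ∨ ∀ ψ : Fock (Orb (FermionTorus 2 L)), IsGroundStateInSector H (2 * m) 0 ψ → ∃ γ : ℂ, (∑ x : FermionTorus 2 L, numberOp x 0 * numberOp x 1 : Matrix (Finset (Orb (FermionTorus 2 L))) (Finset (Orb (FermionTorus 2 L))) ℂ) *ᵥ ψ = γ • ψ := by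
  -- the objects of side `L`
  set T : Matrix (Finset (Orb (FermionTorus 2 L))) (Finset (Orb (FermionTorus 2 L))) ℂ :=
    hubbardTorus 2 L 1 0 with hT
  set D : Matrix (Finset (Orb (FermionTorus 2 L))) (Finset (Orb (FermionTorus 2 L))) ℂ :=
    ∑ x : FermionTorus 2 L, numberOp x 0 * numberOp x 1 with hD
  set S : Submodule ℂ (Fock (Orb (FermionTorus 2 L))) :=
    szSector (Λ := FermionTorus 2 L) (2 * m) 0 with hS
  have hpen : ∀ u : ℝ, hubbardTorus 2 L 1 u = T + (u : ℂ) • D := fun u => hubbardTorus_pencil L u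
  set H : Matrix (Finset (Orb (FermionTorus 2 L))) (Finset (Orb (FermionTorus 2 L))) ℂ :=
    hubbardTorus 2 L 1 U with hH
  have hHpen : H = T + (U : ℂ) • D := hpen U
  set e₀ : ℝ := H.minEnergyOn S with he₀
  set E₀ : Submodule ℂ (Fock (Orb (FermionTorus 2 L))) :=
    S ⊓ Module.End.eigenspace (Matrix.toLin' H) ((e₀ : ℝ) : ℂ) with hE₀
  simp only at hdich
  show Module.finrank ℂ E₀ = 1 ∨ ∀ ψ : Fock (Orb (FermionTorus 2 L)),
    IsGroundStateInSector H (2 * m) 0 ψ → ∃ γ : ℂ, D *ᵥ ψ = γ • ψ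
  refine or_iff_not_imp_left.mpr fun hne ψ hgs => ?_
  -- Hermiticity and invariance of the pencil members
  have hTh : T.IsHermitian := LiebThm1.hamiltonian_isHermitian (fermionTorusGraph 2 L) 1 0
  have hDh : D.IsHermitian := doublon_isHermitian
  have hTK : ∀ v ∈ S, T *ᵥ v ∈ S := fun v hv =>
    hamiltonian_mulVec_mem_szSector (fermionTorusGraph 2 L) 1 0 m hv
  have hDK : ∀ v ∈ S, D *ᵥ v ∈ S := fun v hv => doublon_mulVec_mem_szSector m hv
  -- the ground state `ψ`
  obtain ⟨hψS, hψ0, hHψ⟩ := hgs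
  -- the sector spectral curve; the ground point lies on it, on an irreducible factor `p`
  obtain ⟨χ, hχm, hroots, hmult, hirr⟩ := stub_sectorSpectralCurve T D hTh hDh S hTK hDK
  have hroot : (χ.map (evalRingHom (U : ℂ))).IsRoot ((e₀ : ℝ) : ℂ) := by
    rw [hroots]
    refine ⟨ψ, hψS, hψ0, ?_⟩
    rw [← hHpen]
    exact hHψ
  obtain ⟨p, hp, hpχ, hpU⟩ := hirr _ _ hroot
  rcases hdich χ hχm hroots hmult p hp hpχ hpU with hanch | ⟨ε, γ, hlin, hεU⟩
  · -- ANCHORED: the ground root is simple, `dim E₀ = 1` — excluded by `hne`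
    exfalso
    set Ψ : ℂ[X][X] := (T.map C + (X : ℂ[X]) • D.map C).charpoly with hΨ
    have hΨm : Ψ.Monic := Matrix.charpoly_monic _
    have hΦm : (χ * Ψ).Monic := hχm.mul hΨm
    -- roots of `χ(u)` are eigenvalues of the full pencil: `χ Ψ` and `Ψ` have the same
    -- distinct specialised roots
    have hrootsΦ : ∀ u : ℝ, ((χ * Ψ).map (evalRingHom (u : ℂ))).roots.toFinset =
        (hubbardTorus 2 L 1 u).charpoly.roots.toFinset := by
      intro u
      have hΨu : Ψ.map (evalRingHom (u : ℂ)) = (hubbardTorus 2 L 1 u).charpoly := by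
        rw [hΨ, charpoly_pencil_map_evalRingHom, ← hpen u]
      have hne' : χ.map (evalRingHom (u : ℂ)) * (hubbardTorus 2 L 1 u).charpoly ≠ 0 :=
        mul_ne_zero (hχm.map _).ne_zero (Matrix.charpoly_monic _).ne_zero
      rw [Polynomial.map_mul, hΨu, roots_mul hne', Multiset.toFinset_add]
      refine Finset.union_eq_right.mpr fun μ hμ => ?_
      rw [Multiset.mem_toFinset, mem_roots (Matrix.charpoly_monic _).ne_zero, IsRoot.def,
        eval_charpoly, ← Matrix.exists_mulVec_eq_zero_iff]
      rw [Multiset.mem_toFinset, mem_roots (hχm.map _).ne_zero, hroots] at hμ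
      obtain ⟨v, -, hv0, hv⟩ := hμ
      refine ⟨v, hv0, ?_⟩
      rw [sub_mulVec, hpen u, hv]
      ext i
      simp [Matrix.scalar_apply, Pi.smul_apply]
    have hmax' : ∀ u' : ℝ,
        ((χ * Ψ).map (evalRingHom ((u' : ℝ) : ℂ))).roots.toFinset.card ≤
          ((χ * Ψ).map (evalRingHom (U : ℂ))).roots.toFinset.card := by
      intro u'
      rw [hrootsΦ, hrootsΦ]
      exact hmax u'
    have hsimple := stub_anchorTransferNonexceptional χ (χ * Ψ) p hχm hΦm (dvd_mul_right χ Ψ) hp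
      hpχ hanch U hmax' ((e₀ : ℝ) : ℂ) hpU
    have hfin : Module.finrank ℂ E₀ = 1 := by
      rw [hE₀, hHpen, ← hmult U e₀, hsimple]
    exact hne hfin
  · -- LINEAR: the ground energy is affine near `U`; every ground state is a T/U state
    have hline : ∀ u : ℂ, ∃ v ∈ S, v ≠ 0 ∧ (T + u • D) *ᵥ v = (ε + γ * u) • v := by
      intro u
      rw [← hroots]
      obtain ⟨r, hr⟩ := hlin
      rw [hr, Polynomial.map_mul, IsRoot.def, eval_mul]
      simp
    have hmaxT : ∀ u' : ℝ, (T + ((u' : ℝ) : ℂ) • D).charpoly.roots.toFinset.card ≤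
        (T + (U : ℂ) • D).charpoly.roots.toFinset.card := by
      intro u'
      rw [← hpen u', ← hpen U]
      exact hmax u'
    have hεU' : (((T + (U : ℂ) • D).minEnergyOn S : ℝ) : ℂ) = ε + γ * (U : ℂ) := by
      rw [← hHpen]; exact hεU
    obtain ⟨η, hη, haff⟩ := stub_linearSheetForcesAffineGround T D hTh hDh S hTK hDK U hmaxT ε γ
      hεU' hline
    -- midpoint equality with step `η / 2`
    have hη2 : η / 2 ≠ 0 := by positivity
    have hm_mem : U - η / 2 ∈ Set.Ioo (U - η) (U + η) := by constructor <;> linarith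
    have hp_mem : U + η / 2 ∈ Set.Ioo (U - η) (U + η) := by constructor <;> linarith
    have hU_mem : U ∈ Set.Ioo (U - η) (U + η) := by constructor <;> linarith
    have em : (((T + ((U - η / 2 : ℝ) : ℂ) • D).minEnergyOn
        (szSector (Λ := FermionTorus 2 L) (2 * m) 0) : ℝ) : ℂ) = ε + γ * ((U - η / 2 : ℝ) : ℂ) :=
      haff _ hm_mem
    have ep : (((T + ((U + η / 2 : ℝ) : ℂ) • D).minEnergyOn
        (szSector (Λ := FermionTorus 2 L) (2 * m) 0) : ℝ) : ℂ) = ε + γ * ((U + η / 2 : ℝ) : ℂ) :=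
      haff _ hp_mem
    have eU : (((T + (U : ℂ) • D).minEnergyOn
        (szSector (Λ := FermionTorus 2 L) (2 * m) 0) : ℝ) : ℂ) = ε + γ * (U : ℂ) :=
      haff _ hU_mem
    have hmid : 2 * (hamiltonian (fermionTorusGraph 2 L) 1 U).minEnergyOn (szSector (2 * m) 0) ≤
        (hamiltonian (fermionTorusGraph 2 L) 1 (U - η / 2)).minEnergyOn (szSector (2 * m) 0) +
          (hamiltonian (fermionTorusGraph 2 L) 1 (U + η / 2)).minEnergyOn (szSector (2 * m) 0) := by
      have h1 : hamiltonian (fermionTorusGraph 2 L) 1 U = T + (U : ℂ) • D := hpen U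
      have h2 : hamiltonian (fermionTorusGraph 2 L) 1 (U - η / 2) = T + ((U - η / 2 : ℝ) : ℂ) • D :=
        hpen (U - η / 2)
      have h3 : hamiltonian (fermionTorusGraph 2 L) 1 (U + η / 2) = T + ((U + η / 2 : ℝ) : ℂ) • D :=
        hpen (U + η / 2)
      rw [h1, h2, h3]
      apply le_of_eq
      apply Complex.ofReal_injective
      rw [Complex.ofReal_mul, Complex.ofReal_add, em, ep, eU]
      push_cast
      ring
    have hgs' : IsGroundStateInSector (hamiltonian (fermionTorusGraph 2 L) 1 U) (2 * m) 0 ψ :=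
      ⟨hψS, hψ0, hHψ⟩
    obtain ⟨-, -, hDψ, -⟩ := hubbard_jointEigen_of_midpoint (fermionTorusGraph 2 L) 1 m U (η / 2)
      hη2 hmid hgs'
    exact ⟨_, hDψ⟩

/-- **Simple-or-joint ⇒ anchored-or-linear** (one side `L`, one sector `szSector (2m) 0`, at ANY
coupling `U`). If the sector ground eigenspace of `hubbardTorus 2 L 1 U` is one-dimensional, or
some sector ground state is an eigenvector of the doublon number, then for every sector spectral
curve `χ` (characterised by its complex roots and real multiplicities) every irreducible factor
`p` of `χ` through the ground point is anchored or the ground point lies on a linear sheet of `χ`: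
`dim E₀ = 1` makes the ground point itself an anchor (multiplicity clause), and a joint `T/D`
ground eigenvector `ψ` (`D ψ = γ ψ`, hence `T ψ = (e₀ - γU) ψ`) is an eigenvector of `T + u D` with
eigenvalue `(e₀ - γU) + γ u` at every complex `u`, a root of `χ(u, ·)` at every `u`, so the linear
sheet divides `χ` (`UniqueGround.X_sub_C_dvd_of_forall_isRoot`). With
`finrankOne_or_forall_joint_of_anchoredOrLinear`: at non-exceptional couplings the dichotomy of
`stub_groundSheetAnchored` is EQUIVALENT to "`dim E₀ = 1` or a doublon-eigenvector ground state".
Kato (1966) Ch. II §1.1. [folklore] -/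
theorem anchoredOrLinear_of_finrankOne_or_exists_joint (L : ℕ) [NeZero L] (m : ℕ) (U : ℝ)
    (h :
      let H := hubbardTorus 2 L 1 U
      let S := szSector (Λ := FermionTorus 2 L) (2 * m) 0
      let E₀ := S ⊓ Module.End.eigenspace (Matrix.toLin' H) ((H.minEnergyOn S : ℝ) : ℂ)
      Module.finrank ℂ E₀ = 1 ∨
        ∃ ψ : Fock (Orb (FermionTorus 2 L)), IsGroundStateInSector H (2 * m) 0 ψ ∧
          ∃ γ : ℂ, (∑ x : FermionTorus 2 L, numberOp x 0 * numberOp x 1 :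
            Matrix (Finset (Orb (FermionTorus 2 L))) (Finset (Orb (FermionTorus 2 L))) ℂ) *ᵥ ψ =
              γ • ψ) :
    let T := hubbardTorus 2 L 1 0
    let D : Matrix (Finset (Orb (FermionTorus 2 L))) (Finset (Orb (FermionTorus 2 L))) ℂ :=
      ∑ x : FermionTorus 2 L, numberOp x 0 * numberOp x 1
    let S := szSector (Λ := FermionTorus 2 L) (2 * m) 0
    let e₀ : ℝ := (hubbardTorus 2 L 1 U).minEnergyOn S
    ∀ χ : ℂ[X][X], χ.Monic →
      (∀ u μ : ℂ, (χ.map (evalRingHom u)).IsRoot μ ↔ ∃ v ∈ S, v ≠ 0 ∧ (T + u • D) *ᵥ v = μ • v) →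
      (∀ u μ : ℝ, (χ.map (evalRingHom (u : ℂ))).rootMultiplicity (μ : ℂ) =
        Module.finrank ℂ ↥(S ⊓ Module.End.eigenspace (Matrix.toLin' (T + (u : ℂ) • D)) (μ : ℂ))) →
      ∀ p : ℂ[X][X], Irreducible p → p ∣ χ → (p.map (evalRingHom (U : ℂ))).IsRoot ((e₀ : ℝ) : ℂ) →
        (∃ U₀ μ₀ : ℂ, (p.map (evalRingHom U₀)).IsRoot μ₀ ∧
          (χ.map (evalRingHom U₀)).rootMultiplicity μ₀ = 1) ∨
        (∃ ε γ : ℂ, (X - C (C ε + C γ * X)) ∣ χ ∧ ((e₀ : ℝ) : ℂ) = ε + γ * (U : ℂ)) := by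
  -- the objects of side `L`
  set T : Matrix (Finset (Orb (FermionTorus 2 L))) (Finset (Orb (FermionTorus 2 L))) ℂ :=
    hubbardTorus 2 L 1 0 with hT
  set D : Matrix (Finset (Orb (FermionTorus 2 L))) (Finset (Orb (FermionTorus 2 L))) ℂ :=
    ∑ x : FermionTorus 2 L, numberOp x 0 * numberOp x 1 with hD
  set S : Submodule ℂ (Fock (Orb (FermionTorus 2 L))) :=
    szSector (Λ := FermionTorus 2 L) (2 * m) 0 with hS
  have hpen : ∀ u : ℝ, hubbardTorus 2 L 1 u = T + (u : ℂ) • D := fun u => hubbardTorus_pencil L u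
  set H : Matrix (Finset (Orb (FermionTorus 2 L))) (Finset (Orb (FermionTorus 2 L))) ℂ :=
    hubbardTorus 2 L 1 U with hH
  have hHpen : H = T + (U : ℂ) • D := hpen U
  set e₀ : ℝ := H.minEnergyOn S with he₀
  set E₀ : Submodule ℂ (Fock (Orb (FermionTorus 2 L))) :=
    S ⊓ Module.End.eigenspace (Matrix.toLin' H) ((e₀ : ℝ) : ℂ) with hE₀
  simp only at h ⊢
  intro χ _hχm hroots hmult p _hp _hpχ hpU
  rcases h with hfin | ⟨ψ, ⟨hψS, hψ0, hHψ⟩, γ, hDψ⟩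
  · -- `dim E₀ = 1`: the ground point itself is an anchor
    refine Or.inl ⟨(U : ℂ), ((e₀ : ℝ) : ℂ), hpU, ?_⟩
    rw [hmult U e₀, ← hHpen]
    exact hfin
  · -- a joint `T/D` ground eigenvector rides a linear sheet through the ground point
    refine Or.inr ⟨((e₀ : ℝ) : ℂ) - γ * (U : ℂ), γ, ?_, by ring⟩
    refine X_sub_C_dvd_of_forall_isRoot χ _ γ fun u => ?_
    rw [hroots]
    refine ⟨ψ, hψS, hψ0, ?_⟩
    have hTψ : T *ᵥ ψ = (((e₀ : ℝ) : ℂ) - γ * (U : ℂ)) • ψ := by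
      have h1 : (T + (U : ℂ) • D) *ᵥ ψ = ((e₀ : ℝ) : ℂ) • ψ := by rw [← hHpen]; exact hHψ
      rw [add_mulVec, smul_mulVec, hDψ, smul_smul] at h1
      rw [sub_smul, mul_comm γ, ← h1, add_sub_cancel_right]
    rw [add_mulVec, smul_mulVec, hDψ, hTψ, smul_smul, ← add_smul]
    congr 1
    ring

end Summit.HubbardSuperconductivity.HubbardSuperconductivity.Theorems
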